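import Summits.QuantumFields.YangMills.Theorems.UnitScaleTiltProp7CombLadder
import HarnessLib

/-!
# Route `UnitScaleTilt`, crux K1 «MinimiserStabilityRegPr» (stmt-QuantumFields-19200), route-R E′ path (α′), S3 K-form engine, row (R4′) — FILE 9g′ (torus letters):
# THE OFFSET FAMILY OF AXIAL MODELS — shifting the base `c ↦ c + h·e_ι` and transporting the datum along the straight segment keeps the interpolation at `c`:
# `R((axialT W (c + h e_ι) c)⁻¹)(R(W([c, c + h e_ι])⁻¹) m) = m` — the displayed `hinterp` row of ✓ `Prop7LocalModelAverage.lemmaH_curved_comb_avg` for the comb-averaging cure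

Cell `ym3-torus`, D-0154 (3c) twin-width seat `ym-routeR-w1` (gen 6); row (R4′) (namer ★ym-ust-19200-p1 g15; standing PASS 21:15Z; LOCATE v1.1 = 19200 evidence #52 §4 (c3);
px17 g2's cure 21:02Z).  THEOREMS ONLY (0 `def`, 0 `sorry`); `--supports stmt-QuantumFields-19200`, count-neutral.  YM₃ on T³ is a ladder rung (R3), not the Clay problem; nothing
here claims a stub, the crux, d = 4 or the mass gap.

WHAT (ns `…Theorems.Prop7AxialOffsetFamily`; torus `Site P j`, any group `G` ∕ ring `𝔸`).
* §1 `flatMap_seg_zero`, ★ `treeWord_single` (`Γ(n·e_ι) = seg ι n`: the comb of a vector along one axis is the straight segment),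
  ★★ `axialT_transl_seg` (`axialT V (transl c (h•e_ι)) c = (holT V c (seg ι h))⁻¹` when `2|h| < N`: the comb from the shifted base back to `c` is the reversed segment).
* §2 ★★ `offsetFamily_interp` (any ring of units): `R((axialT V (transl c (h•e_ι)) c)⁻¹)(R((holT V c (seg ι h))⁻¹) m) = m` — so the family `c^h := c + h e_ι`,
  `m^h := R(W([c,c^h])⁻¹)m`, `h ∈ Fin ℓ`, inhabits `hinterp` of ✓ `lemmaH_curved_comb_avg`.
HONEST SCOPE.  Bookkeeping of ✓ `B10Eq27TorusAxialLog` letters (`transl`, `rel`, `hol_pull`, `revWord_seg`); no estimate, no count.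

References: T. Bałaban, CMP 98 (1985) 17–51 [Balaban1985Averaging] ((9) p.18, p.24); CMP 102 (1985) 255–275 [Balaban1985UV3] ((27) p.263); CMP 116 (1988) 1–22 [Balaban1987RG1] ((0.1) p.251).
-/

set_option autoImplicit false

noncomputable section

namespace Summit.QuantumFields.YangMills.Theorems.Prop7AxialOffsetFamily

open Literature.MathematicalPhysics.QuantumFieldTheory.Balaban1983to89
open B7Prop1Explicit (Letter e disp revWord seg treeWord hol hol_append hol_revWord' disp_seg revWord_seg seg_zero)
open B9Eq39Adjoint (R R_R_inv)
open B10Eq27TorusAxialLog (holT axialT rel transl hol_pull hol_pull_zero rel_transl_of_mem transl_add transl_zero)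
open Summit.QuantumFields.YangMills.Theorems.Prop7CombLadder (treeWord_split finRange_reverse_split)

/-! ## §1 The comb from a shifted base -/

section Words

variable {d : ℕ}

/-- runs of length zero contribute nothing. [folklore] -/
theorem flatMap_seg_zero (ι : Fin d) (n : ℤ) {l : List (Fin d)} (hl : ι ∉ l) :
    l.flatMap (fun κ => seg κ ((n • e ι : B7Prop1Explicit.Site d) κ)) = [] := by
  rw [List.flatMap_eq_nil_iff]
  intro κ hκ
  have hne : κ ≠ ι := fun hh => hl (hh ▸ hκ)
  rw [Pi.smul_apply, B7Prop1Explicit.e_apply, if_neg hne, smul_zero, seg_zero]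

/-- ★ the comb of a vector along one axis is the straight segment: `Γ(n·e_ι) = seg ι n`. [cite: Balaban1985Averaging, p.24] -/
theorem treeWord_single (ι : Fin d) (n : ℤ) : treeWord (n • e ι : B7Prop1Explicit.Site d) = seg ι n := by
  obtain ⟨s, t, h, hs, ht⟩ := finRange_reverse_split ι
  rw [treeWord_split _ ι h, flatMap_seg_zero ι n hs, flatMap_seg_zero ι n ht, Pi.smul_apply, B7Prop1Explicit.e_apply, if_pos rfl, smul_eq_mul,
    mul_one, List.nil_append, List.append_nil]

end Words

section Torus

variable {P : Params} {j : ℕ} {G : Type*} [Group G] (V : GaugeField P j G)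

/-- ★★ **THE COMB FROM THE SHIFTED BASE BACK TO THE CENTRE IS THE REVERSED SEGMENT**: `axialT V (c + h·e_ι) c = (V([c, c + h·e_ι]))⁻¹` when the segment does not wrap
(`2|h| < N`). [cite: Balaban1985Averaging, (9) p.18, p.24; Balaban1985UV3, (27) p.263] -/
theorem axialT_transl_seg (c : Site P j) (ι : Fin P.d) (h : ℤ) (hwin : h.natAbs * 2 < P.sitesPerDir j) :
    axialT V (transl c (h • e ι)) c = (holT V c (seg ι h))⁻¹ := by
  have hN : (0 : ℤ) < (P.sitesPerDir j : ℤ) := by exact_mod_cast Nat.pos_of_ne_zero (P.sitesPerDir_ne_zero j)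
  have h2 : (h.natAbs : ℤ) * 2 < (P.sitesPerDir j : ℤ) := by exact_mod_cast hwin
  have hwinν : ∀ ν, ((-h) • e ι : B7Prop1Explicit.Site P.d) ν * 2 ∈ Set.Ioc (-(P.sitesPerDir j : ℤ)) (P.sitesPerDir j) := by
    intro ν
    rw [Pi.smul_apply, B7Prop1Explicit.e_apply]
    by_cases hν : ν = ι
    · rw [if_pos hν, smul_eq_mul, mul_one]
      have h3 : -(h.natAbs : ℤ) ≤ h ∧ h ≤ (h.natAbs : ℤ) := by
        rcases Int.natAbs_eq h with hh | hh <;> constructor <;> omega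
      constructor <;> omega
    · rw [if_neg hν, smul_zero, zero_mul]
      exact ⟨by omega, hN.le⟩
  set c' := transl c (h • e ι) with hc'
  have hc : transl c' ((-h) • e ι) = c := by
    rw [hc', ← transl_add, ← add_smul, add_neg_cancel, zero_smul, transl_zero]
  have hrel : rel c' c = (-h) • e ι := by
    calc rel c' c = rel c' (transl c' ((-h) • e ι)) := by rw [hc]
      _ = (-h) • e ι := rel_transl_of_mem _ _ hwinν
  rw [axialT, hrel, treeWord_single, ← revWord_seg, hc', ← hol_pull_zero V c (seg ι h), ← hol_pull V c, ← disp_seg ι h]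
  exact hol_revWord' _ _ _ (by rw [zero_add])

end Torus

/-! ## §2 The interpolation row of the offset family -/

section Interp

variable {P : Params} {j : ℕ} {𝔸 : Type*} [Ring 𝔸] (V : GaugeField P j 𝔸ˣ)

/-- ★★ **THE OFFSET FAMILY INTERPOLATES**: `R((axialT V (c + h·e_ι) c)⁻¹)(R(V([c, c + h·e_ι])⁻¹) m) = m` — the `hinterp` row of ✓ `lemmaH_curved_comb_avg` for bases shifted
along one axis and data transported along the straight segment. [cite: Balaban1985Averaging, (9) p.18, p.24] -/
theorem offsetFamily_interp (c : Site P j) (ι : Fin P.d) (h : ℤ) (hwin : h.natAbs * 2 < P.sitesPerDir j) (m : 𝔸) :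
    R (axialT V (transl c (h • e ι)) c)⁻¹ (R (holT V c (seg ι h))⁻¹ m) = m := by
  rw [axialT_transl_seg V c ι h hwin, inv_inv, R_R_inv]

end Interp

end Summit.QuantumFields.YangMills.Theorems.Prop7AxialOffsetFamily

end
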